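import Literature.NumberTheory.GaloisRepresentations.IdeleLocalInvariants
import HarnessLib

/-!
# `H²(Gal(E/F), J_E) ≅ ⨁_v (1/n_v)ℤ/ℤ`: local degrees, the images of the local invariants, and classes with
# prescribed invariants (Tate, C–F VII §7.3 Cor. 7.4 (b); Harari Prop. 13.1 (b))

Topic `NumberTheory/GaloisRepresentations`; namespace `Literature.NumberTheory.GaloisRepresentations.IdeleCohomology`,
continuing `IdeleLocalInvariants.lean` (`localInvAt`, `localInvInfAt`, `localInv`, `localInvInf`, `inv`,
`eq_zero_of_forall_localInv_eq_zero`) and `IdeleSUnitsCohomology.lean` (`groupCohomologyIso S n : Hⁿ(G, J_{E,S}) ≅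
∏_i Hⁿ(G, blockFamily E S i)`).  Definitions with bodies (`localDegree`, `infLocalDegree`, `unitsInvAt`, `archInvAt`,
`invFamily`) and theorems; NO named fact, no `sorry`, no instance, no notation; number fields in `Type`.

Mathematics.  Tate, Cor. 7.4 (b) [held copy `book:editornd-algebraic-number-theory` p0217]: "`H²(G, J_L) ≃ ⨿_v
((1/n_v) ℤ/ℤ)`, where `n_v = [L^v : K_v]`".  The file `IdeleLocalInvariants` gave the maps `inv_v` and the injectivity
of `c ↦ (inv_v c)_v`; here the IMAGE: (§1) the local degree `n_v = #G_w = [E_w : F_v]` is independent of `w ∣ v`;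
(§2) on the `v`-block, `inv_v` maps `H²(G, ∏_{w∣v} E_wˣ) ≅ H²(G_w, E_wˣ)` onto the `n_v`-torsion `(1/n_v)ℤ/ℤ` of `ℚ/ℤ`
(door-c6's `range_layerInv`; at `v ∣ ∞` the cyclic group of order `n_v ∈ {1,2}`); (§3) every family of block classes is
the family of components of a class of `Hⁿ(G, J_E)` (the block isomorphism of `J_{E,S}` pushed to `J_E`); (§4) hence the
image of `c ↦ ((inv_v c)_v, (inv_v c)_{v∣∞})` is exactly the set of finitely supported families with `n_v · t_v = 0`,
and the map is injective: **`H²(Gal(E/F), J_E) ≅ ⨁_v (1/n_v)ℤ/ℤ`** (`invFamily_injective`, `range_invFamily`).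

## What is formalised (`F E : Type` number fields, `E/F` Galois, `G = E ≃ₐ[F] E`)

* §1 `natCard_stabilizer_place_eq`, `localDegree E v` (`= #G_w = [E_w:F_v]` for every `w ∣ v`), `infLocalDegree E v`
  (`∈ {1, 2}`).
* §2 `unitsInvAt w`, `range_unitsInvAt` (`= {t | n_v • t = 0}`), `archInvAt w₀`, `range_archLayerInv`, `range_archInvAt`.
* §3 `exists_blocks_eq`, **`exists_placeComponents_eq`** (classes of `Hⁿ(G, J_E)` with prescribed components, every
  `n`), `exists_placeComponent_eq`, `exists_infPlaceComponent_eq`, `map_placeProj_surjective`,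
  `map_infPlaceProj_surjective`.
* §4 `range_localInvAt`, `range_localInvInfAt`, `localDegree_nsmul_localInv`, `infLocalDegree_nsmul_localInvInf`,
  `localInvInf_eq_zero_iff`, `eq_zero_of_forall_localInv_eq_zero'`, `eq_of_forall_localInv_eq`,
  **`exists_localInv_eq`** (a class with prescribed finitely supported invariants `t_v ∈ (1/n_v)ℤ/ℤ`).
* §5 `invFamily : H²(G, J_E) →+ (∏_v ℚ/ℤ) × (∏_{v∣∞} ℚ/ℤ)`, **`invFamily_injective`**, **`range_invFamily`**.

Not here: `localInvAt w` is independent of `w ∣ v` (only `n_v` is shown to be); the reciprocity law.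

## References
* J. W. S. Cassels, A. Fröhlich (eds.), *Algebraic Number Theory* (1967), Ch. VII (Tate) §7.3 Prop. 7.3, Cor. 7.4 (b).
  [CasselsFrohlichANT1967]
* D. Harari, *Galois Cohomology and Class Field Theory*, Springer (2020), §13.1 Prop. 13.1 (b). [Harari2020]
* J.-P. Serre, *Local Fields*, GTM 67 (1979), Ch. XIII §3 Prop. 6, Cor. 2 to Prop. 7. [SerreLocalFields1979]
-/

noncomputable section

open NumberField NumberField.InfinitePlace IsDedekindDomain CategoryTheory CategoryTheory.Limits groupCohomology
open Literature.NumberTheory.Automorphic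
open Literature.AnabelianGeometry.AbsoluteAnabelian.Prop121vii

namespace Literature.NumberTheory.GaloisRepresentations

namespace IdeleCohomology

open Literature.Algebra.Homology SemiLocal

variable {F : Type} [Field F] [NumberField F] {E : Type} [Field E] [NumberField E] [Algebra F E] [IsGalois F E]

/-! ## §1. The local degrees `n_v = #G_w = [E_w : F_v]` -/

variable {v : HeightOneSpectrum (𝓞 F)}

/-- The decomposition groups of two places above `v` have the same order (they are conjugate, `Gal(E/F)` acting
transitively on the places above `v`). [cite: CasselsFrohlichANT1967, Ch. VII §7.2] -/
theorem natCard_stabilizer_place_eq (w w' : Place F E v) :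
    Nat.card (MulAction.stabilizer (E ≃ₐ[F] E) w) = Nat.card (MulAction.stabilizer (E ≃ₐ[F] E) w') := by
  obtain ⟨σ, hσ⟩ := Place.exists_smul_eq w w'
  exact Nat.card_congr (MulAction.stabilizerEquivStabilizer hσ.symm).toEquiv

variable (E) in
/-- **The local degree `n_v`** of the Galois extension `E/F` at a finite place `v`: the order of the decomposition group
`G_w` of a place `w ∣ v` (`= [E_w : F_v]`, independent of `w`). [cite: CasselsFrohlichANT1967, Ch. VII §7.3 Cor. 7.4 (b)] -/
def localDegree (v : HeightOneSpectrum (𝓞 F)) : ℕ :=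
  Nat.card (MulAction.stabilizer (E ≃ₐ[F] E) (chosenPlace (E := E) v))

/-- `n_v = #G_w` for every `w ∣ v`. [cite: CasselsFrohlichANT1967, Ch. VII §7.3 Cor. 7.4 (b)] -/
theorem localDegree_eq_natCard_stabilizer (w : Place F E v) :
    localDegree E v = Nat.card (MulAction.stabilizer (E ≃ₐ[F] E) w) :=
  natCard_stabilizer_place_eq _ w

/-- `n_v = [E_w : F_v]` for every `w ∣ v`. [cite: CasselsFrohlichANT1967, Ch. VII §7.3 Cor. 7.4 (b)] -/
theorem localDegree_eq_finrank (w : Place F E v) :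
    localDegree E v = Module.finrank (v.adicCompletion F) ((w : HeightOneSpectrum (𝓞 E)).adicCompletion E) := by
  rw [localDegree_eq_natCard_stabilizer w, finrank_place_eq_card_stabilizer w]

omit [IsGalois F E] in
/-- `n_v ≥ 1`. [cite: CasselsFrohlichANT1967, Ch. VII §7.3 Cor. 7.4 (b)] -/
theorem localDegree_pos (v : HeightOneSpectrum (𝓞 F)) : 0 < localDegree E v := Nat.card_pos

omit [NumberField F] [NumberField E] in
/-- The decomposition groups of two infinite places above the same place of `F` have the same order.
[cite: CasselsFrohlichANT1967, Ch. VII §7.2] -/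
theorem natCard_stabilizer_infinitePlace_eq {w₀ w₁ : InfinitePlace E}
    (h : w₀.comap (algebraMap F E) = w₁.comap (algebraMap F E)) :
    Nat.card (MulAction.stabilizer (E ≃ₐ[F] E) w₀) = Nat.card (MulAction.stabilizer (E ≃ₐ[F] E) w₁) := by
  obtain ⟨σ, hσ⟩ := InfinitePlace.exists_smul_eq_of_comap_eq (k := F) h
  exact Nat.card_congr (MulAction.stabilizerEquivStabilizer hσ.symm).toEquiv

variable (E) in
/-- **The local degree `n_v ∈ {1, 2}`** of `E/F` at an infinite place `v`: the order of the decomposition group of a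
place above `v`. [cite: CasselsFrohlichANT1967, Ch. VII §7.3 Cor. 7.4 (b)] -/
def infLocalDegree (v : InfinitePlace F) : ℕ :=
  Nat.card (MulAction.stabilizer (E ≃ₐ[F] E) (ArchHerbrand.placeOver E v))

omit [NumberField F] [NumberField E] in
/-- `n_v = #G_{w₀}` for every `w₀ ∣ v`. [cite: CasselsFrohlichANT1967, Ch. VII §7.3 Cor. 7.4 (b)] -/
theorem infLocalDegree_eq_natCard_stabilizer {v : InfinitePlace F} {w₀ : InfinitePlace E}
    (h : ArchHerbrand.IsOver E v w₀) : infLocalDegree E v = Nat.card (MulAction.stabilizer (E ≃ₐ[F] E) w₀) :=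
  natCard_stabilizer_infinitePlace_eq ((ArchHerbrand.isOver_placeOver (E := E) v).trans h.symm)

omit [NumberField F] [NumberField E] in
/-- `n_v ∈ {1, 2}` at an infinite place. [cite: CasselsFrohlichANT1967, Ch. VII §7.3 Cor. 7.4 (b)] -/
theorem infLocalDegree_eq_one_or_two (v : InfinitePlace F) : infLocalDegree E v = 1 ∨ infLocalDegree E v = 2 :=
  InfinitePlace.nat_card_stabilizer_eq_one_or_two F _

/-! ## §2. The invariant on the `v`-block and its image `(1/n_v)ℤ/ℤ` -/

omit [IsGalois F E] in
/-- `F_v` has characteristic `0`. [cite: CasselsFrohlichANT1967, Ch. II §10] -/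
private theorem charZero_adicCompletion_base' (v : HeightOneSpectrum (𝓞 F)) : CharZero (v.adicCompletion F) :=
  charZero_of_injective_algebraMap (algebraMap F (v.adicCompletion F)).injective

/-- **The invariant on the `v`-block `H²(G, ∏_{w'∣v} E_{w'}ˣ) ≅ H²(G_w, E_wˣ) → ℚ/ℤ`** (Shapiro, then door-c6's
`layerInv`). [cite: CasselsFrohlichANT1967, Ch. VII §7.3 Cor. 7.4 (b)][cite: SerreLocalFields1979, Ch. XIII §3] -/
def unitsInvAt (w : Place F E v) : groupCohomology (unitsRep F E v) 2 →+ AddCircle (1 : ℚ) :=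
  haveI := charZero_adicCompletion_base' v
  haveI := finiteDimensional_place (K := F) w
  haveI := isGalois_place (F := F) w
  (UnitsLayer.layerInv (v.adicCompletion F) ((w : HeightOneSpectrum (𝓞 E)).adicCompletion E)).comp
    (groupCohomologyUnitsRepIsoAut w 2).hom.hom.toAddMonoidHom

/-- `inv_v(c) = unitsInvAt w (component of c at v)`. [cite: CasselsFrohlichANT1967, Ch. VII §7.3 Cor. 7.4 (b)] -/
theorem localInvAt_eq_unitsInvAt (w : Place F E v) (c : groupCohomology (IdeleClassGroup.ideleRep F E) 2) :
    localInvAt w c = unitsInvAt w (groupCohomology.map (MonoidHom.id (E ≃ₐ[F] E)) (placeProj v) 2 c) := rfl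

/-- **The image of the block invariant is the `n_v`-torsion `(1/n_v)ℤ/ℤ` of `ℚ/ℤ`**, `n_v = #G_w`
(door-c6's `range_layerInv`, Shapiro is an isomorphism). [cite: SerreLocalFields1979, Ch. XIII §3 Prop. 6]
[cite: CasselsFrohlichANT1967, Ch. VII §7.3 Cor. 7.4 (b)] -/
theorem range_unitsInvAt (w : Place F E v) :
    Set.range (unitsInvAt w) = {t : AddCircle (1 : ℚ) | Nat.card (MulAction.stabilizer (E ≃ₐ[F] E) w) • t = 0} := by
  haveI := charZero_adicCompletion_base' v
  haveI := finiteDimensional_place (K := F) w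
  haveI := isGalois_place (F := F) w
  haveI : NeZero (Nat.card (MulAction.stabilizer (E ≃ₐ[F] E) w)) := ⟨Nat.card_pos.ne'⟩
  have hsurj : Function.Surjective (groupCohomologyUnitsRepIsoAut w 2).hom.hom.toAddMonoidHom :=
    (groupCohomologyUnitsRepIsoAut w 2).toLinearEquiv.surjective
  rw [unitsInvAt, AddMonoidHom.coe_comp, hsurj.range_comp,
    UnitsLayer.range_layerInv (v.adicCompletion F) ((w : HeightOneSpectrum (𝓞 E)).adicCompletion E)
      (finrank_place_eq_card_stabilizer w), UnitsLayer.range_zmodToQmodZ_eq]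

omit [NumberField F] [NumberField E] in
/-- **The image of the archimedean invariant `H²(G_{w₀}, E_{w₀}ˣ) → ℚ/ℤ` is the `n_v`-torsion of `ℚ/ℤ`**, `n_v = #G_{w₀}`.
[cite: CasselsFrohlichANT1967, Ch. VII §7.3 Cor. 7.4 (b)] -/
theorem range_archLayerInv [FiniteDimensional F E] (w₀ : InfinitePlace E) :
    Set.range (archLayerInv (F := F) w₀) =
      {t : AddCircle (1 : ℚ) | Nat.card (MulAction.stabilizer (E ≃ₐ[F] E) w₀) • t = 0} := by
  haveI := neZero_natCard_H2_archLocalUnitsRep (F := F) w₀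
  have hsurj : Function.Surjective
      (zmodAddCyclicAddEquiv (isAddCyclic_H2_archLocalUnitsRep (F := F) w₀)).symm.toAddMonoidHom :=
    (zmodAddCyclicAddEquiv (isAddCyclic_H2_archLocalUnitsRep (F := F) w₀)).symm.surjective
  rw [archLayerInv, AddMonoidHom.coe_comp, hsurj.range_comp, UnitsLayer.range_zmodToQmodZ_eq,
    ArchHerbrand.natCard_H2_archLocalUnitsRep w₀]

/-- **The invariant on the block at the infinite place below `w₀`: `H²(G, ∏_{w∣v} E_wˣ) ≅ H²(G_{w₀}, E_{w₀}ˣ) → ℚ/ℤ`.**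
[cite: CasselsFrohlichANT1967, Ch. VII §7.3 Cor. 7.4 (b)] -/
def archInvAt (w₀ : InfinitePlace E) :
    groupCohomology (ArchHerbrand.archUnitsRep (E := E) (w₀.comap (algebraMap F E))) 2 →+ AddCircle (1 : ℚ) :=
  (archLayerInv (F := F) w₀).comp (ArchHerbrand.groupCohomologyArchUnitsRepIso w₀ 2).hom.hom.toAddMonoidHom

/-- `inv_v(c) = archInvAt w₀ (component of c at v = w₀|_F)`. [cite: CasselsFrohlichANT1967, Ch. VII §7.3 Cor. 7.4 (b)] -/
theorem localInvInfAt_eq_archInvAt (w₀ : InfinitePlace E) (c : groupCohomology (IdeleClassGroup.ideleRep F E) 2) :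
    localInvInfAt w₀ c =
      archInvAt w₀ (groupCohomology.map (MonoidHom.id (E ≃ₐ[F] E)) (infPlaceProj (w₀.comap (algebraMap F E))) 2 c) :=
  rfl

/-- The image of `archInvAt w₀` is the `n_v`-torsion of `ℚ/ℤ`. [cite: CasselsFrohlichANT1967, Ch. VII §7.3 Cor. 7.4 (b)] -/
theorem range_archInvAt (w₀ : InfinitePlace E) :
    Set.range (archInvAt (F := F) w₀) =
      {t : AddCircle (1 : ℚ) | Nat.card (MulAction.stabilizer (E ≃ₐ[F] E) w₀) • t = 0} := by
  have hsurj : Function.Surjective (ArchHerbrand.groupCohomologyArchUnitsRepIso (F := F) w₀ 2).hom.hom.toAddMonoidHom :=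
    (ArchHerbrand.groupCohomologyArchUnitsRepIso w₀ 2).toLinearEquiv.surjective
  rw [archInvAt, AddMonoidHom.coe_comp, hsurj.range_comp, range_archLayerInv]

/-! ## §3. Classes of `Hⁿ(G, J_E)` with prescribed components -/

variable {S : Finset (HeightOneSpectrum (𝓞 F))}

omit [IsGalois F E] in
variable (S) in
/-- Every family of block classes is the family of blocks of a class of `Hⁿ(G, J_{E,S})` (the block isomorphism).
[cite: CasselsFrohlichANT1967, Ch. VII §7.3] -/
theorem exists_blocks_eq (n : ℕ) (fam : ∀ i : BlockIndex S, groupCohomology (blockFamily E S i) n) :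
    ∃ c' : groupCohomology (ideleSRep F E S) n,
      ∀ i, groupCohomology.map (MonoidHom.id (E ≃ₐ[F] E)) (blockProj S i) n c' = fam i :=
  ⟨(groupCohomologyIso S n).inv fam, fun i => by
    rw [← groupCohomologyIso_hom_apply]
    exact congr_fun (Iso.inv_hom_id_apply (groupCohomologyIso S n) fam) i⟩

omit [IsGalois F E] in
variable (S) in
/-- **Classes of `Hⁿ(Gal(E/F), J_E)` with prescribed components** (every `n`): given block classes
`y_v ∈ Hⁿ(G, ∏_{w∣v} E_wˣ)` (`v ∈ S`), `u_v ∈ Hⁿ(G, ∏_{w∣v} 𝒪_wˣ)` (`v ∉ S`), `z_v ∈ Hⁿ(G, ∏_{w∣v} E_wˣ)` (`v ∣ ∞`),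
there is a class of `Hⁿ(G, J_E)` with these components (off `S` through `∏ 𝒪_wˣ ↪ ∏ E_wˣ`) — the block decomposition
of `Hⁿ(G, J_{E,S})` pushed along `J_{E,S} ↪ J_E`. [cite: CasselsFrohlichANT1967, Ch. VII §7.3 Prop. 7.3] -/
theorem exists_placeComponents_eq (n : ℕ) (fam : ∀ i : BlockIndex S, groupCohomology (blockFamily E S i) n) :
    ∃ c : groupCohomology (IdeleClassGroup.ideleRep F E) n,
      (∀ (v : HeightOneSpectrum (𝓞 F)) (hv : v ∈ S),
          groupCohomology.map (MonoidHom.id (E ≃ₐ[F] E)) (placeProj v) n c = fam (Sum.inl ⟨v, hv⟩)) ∧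
      (∀ (v : HeightOneSpectrum (𝓞 F)) (hv : v ∉ S),
          groupCohomology.map (MonoidHom.id (E ≃ₐ[F] E)) (placeProj v) n c =
            groupCohomology.map (MonoidHom.id (E ≃ₐ[F] E)) (unitGroupRepHom F E v) n
              (fam (Sum.inr (Sum.inl ⟨v, hv⟩)))) ∧
      (∀ v : InfinitePlace F,
          groupCohomology.map (MonoidHom.id (E ≃ₐ[F] E)) (infPlaceProj v) n c = fam (Sum.inr (Sum.inr v))) := by
  obtain ⟨c', hc'⟩ := exists_blocks_eq S n fam
  refine ⟨groupCohomology.map (MonoidHom.id (E ≃ₐ[F] E)) (ideleSRepHom S) n c', fun v hv => ?_, fun v hv => ?_,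
    fun v => ?_⟩
  · rw [← map_comp_apply, ideleSRepHom_comp_placeProj]
    exact hc' (Sum.inl ⟨v, hv⟩)
  · rw [← map_comp_apply, ideleSRepHom_comp_placeProj, ← blockUnitGroup_comp_unitGroupRepHom S hv, map_comp_apply]
    exact congrArg _ (hc' (Sum.inr (Sum.inl ⟨v, hv⟩)))
  · rw [← map_comp_apply, ideleSRepHom_comp_infPlaceProj]
    exact hc' (Sum.inr (Sum.inr v))

omit [IsGalois F E] in
/-- A class of `Hⁿ(G, J_E)` with prescribed component at ONE finite place `v` and zero components elsewhere.
[cite: CasselsFrohlichANT1967, Ch. VII §7.3 Prop. 7.3] -/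
theorem exists_placeComponent_eq (v : HeightOneSpectrum (𝓞 F)) (n : ℕ) (y : groupCohomology (unitsRep F E v) n) :
    ∃ c : groupCohomology (IdeleClassGroup.ideleRep F E) n,
      groupCohomology.map (MonoidHom.id (E ≃ₐ[F] E)) (placeProj v) n c = y ∧
      (∀ v' : HeightOneSpectrum (𝓞 F), v' ≠ v →
          groupCohomology.map (MonoidHom.id (E ≃ₐ[F] E)) (placeProj v') n c = 0) ∧
      (∀ v' : InfinitePlace F, groupCohomology.map (MonoidHom.id (E ≃ₐ[F] E)) (infPlaceProj v') n c = 0) := by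
  classical
  have hv : v ∈ ({v} : Finset (HeightOneSpectrum (𝓞 F))) := Finset.mem_singleton_self v
  obtain ⟨c, h₁, h₂, h₃⟩ :=
    exists_placeComponents_eq (E := E) {v} n (Function.update 0 (Sum.inl ⟨v, hv⟩) y)
  refine ⟨c, ?_, fun v' hv' => ?_, fun v' => ?_⟩
  · rw [h₁ v hv, Function.update_self]
  · have hv'S : v' ∉ ({v} : Finset (HeightOneSpectrum (𝓞 F))) := fun h => hv' (Finset.mem_singleton.1 h)
    rw [h₂ v' hv'S, Function.update_of_ne Sum.inr_ne_inl, Pi.zero_apply, map_zero]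
  · rw [h₃ v', Function.update_of_ne Sum.inr_ne_inl, Pi.zero_apply]
    rfl

omit [IsGalois F E] in
/-- A class of `Hⁿ(G, J_E)` with prescribed component at ONE infinite place `v` and zero components elsewhere.
[cite: CasselsFrohlichANT1967, Ch. VII §7.3 Prop. 7.3] -/
theorem exists_infPlaceComponent_eq (v : InfinitePlace F) (n : ℕ)
    (z : groupCohomology (ArchHerbrand.archUnitsRep (E := E) v) n) :
    ∃ c : groupCohomology (IdeleClassGroup.ideleRep F E) n,
      groupCohomology.map (MonoidHom.id (E ≃ₐ[F] E)) (infPlaceProj v) n c = z ∧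
      (∀ v' : HeightOneSpectrum (𝓞 F), groupCohomology.map (MonoidHom.id (E ≃ₐ[F] E)) (placeProj v') n c = 0) ∧
      (∀ v' : InfinitePlace F, v' ≠ v →
          groupCohomology.map (MonoidHom.id (E ≃ₐ[F] E)) (infPlaceProj v') n c = 0) := by
  classical
  obtain ⟨c, -, h₂, h₃⟩ :=
    exists_placeComponents_eq (E := E) (∅ : Finset (HeightOneSpectrum (𝓞 F))) n
      (Function.update 0 (Sum.inr (Sum.inr v)) z)
  refine ⟨c, ?_, fun v' => ?_, fun v' hv' => ?_⟩
  · rw [h₃ v, Function.update_self]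
  · rw [h₂ v' (Finset.notMem_empty v'), Function.update_of_ne (by simp), Pi.zero_apply, map_zero]
  · rw [h₃ v', Function.update_of_ne (by simpa using hv'), Pi.zero_apply]
    rfl

omit [IsGalois F E] in
/-- **The component map `Hⁿ(G, J_E) → Hⁿ(G, ∏_{w∣v} E_wˣ)` at a finite place is surjective.**
[cite: CasselsFrohlichANT1967, Ch. VII §7.3 Prop. 7.3] -/
theorem map_placeProj_surjective (v : HeightOneSpectrum (𝓞 F)) (n : ℕ) :
    Function.Surjective
      (groupCohomology.map (MonoidHom.id (E ≃ₐ[F] E)) (A := IdeleClassGroup.ideleRep F E) (placeProj v) n) :=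
  fun y => by
  obtain ⟨c, hc, -, -⟩ := exists_placeComponent_eq v n y
  exact ⟨c, hc⟩

omit [IsGalois F E] in
/-- **The component map `Hⁿ(G, J_E) → Hⁿ(G, ∏_{w∣v} E_wˣ)` at an infinite place is surjective.**
[cite: CasselsFrohlichANT1967, Ch. VII §7.3 Prop. 7.3] -/
theorem map_infPlaceProj_surjective (v : InfinitePlace F) (n : ℕ) :
    Function.Surjective
      (groupCohomology.map (MonoidHom.id (E ≃ₐ[F] E)) (A := IdeleClassGroup.ideleRep F E) (infPlaceProj v) n) :=
  fun z => by
  obtain ⟨c, hc, -, -⟩ := exists_infPlaceComponent_eq v n z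
  exact ⟨c, hc⟩

/-! ## §4. The images of the local invariants; classes with prescribed invariants -/

/-- **`inv_v (H²(G, J_E)) = (1/n_v)ℤ/ℤ`** at a finite place (read at `w ∣ v`, `n_v = #G_w`).
[cite: CasselsFrohlichANT1967, Ch. VII §7.3 Cor. 7.4 (b)] -/
theorem range_localInvAt (w : Place F E v) :
    Set.range (localInvAt w) = {t : AddCircle (1 : ℚ) | Nat.card (MulAction.stabilizer (E ≃ₐ[F] E) w) • t = 0} := by
  rw [← range_unitsInvAt w]
  ext t
  constructor
  · rintro ⟨c, rfl⟩
    exact ⟨_, (localInvAt_eq_unitsInvAt w c).symm⟩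
  · rintro ⟨y, rfl⟩
    obtain ⟨c, hc⟩ := map_placeProj_surjective (E := E) v 2 y
    exact ⟨c, by rw [localInvAt_eq_unitsInvAt, hc]⟩

/-- **`inv_v (H²(G, J_E)) = (1/n_v)ℤ/ℤ`** at an infinite place (read at `w₀`, `n_v = #G_{w₀} ∈ {1,2}`).
[cite: CasselsFrohlichANT1967, Ch. VII §7.3 Cor. 7.4 (b)] -/
theorem range_localInvInfAt (w₀ : InfinitePlace E) :
    Set.range (localInvInfAt (F := F) w₀) =
      {t : AddCircle (1 : ℚ) | Nat.card (MulAction.stabilizer (E ≃ₐ[F] E) w₀) • t = 0} := by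
  rw [← range_archInvAt w₀]
  ext t
  constructor
  · rintro ⟨c, rfl⟩
    exact ⟨_, (localInvInfAt_eq_archInvAt w₀ c).symm⟩
  · rintro ⟨z, rfl⟩
    obtain ⟨c, hc⟩ := map_infPlaceProj_surjective (E := E) (w₀.comap (algebraMap F E)) 2 z
    exact ⟨c, by rw [localInvInfAt_eq_archInvAt, hc]⟩

/-- `n_{w₀} · inv_v(c) = 0` at an infinite place. [cite: CasselsFrohlichANT1967, Ch. VII §7.3 Cor. 7.4 (b)] -/
theorem natCard_stabilizer_nsmul_localInvInfAt (w₀ : InfinitePlace E)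
    (c : groupCohomology (IdeleClassGroup.ideleRep F E) 2) :
    Nat.card (MulAction.stabilizer (E ≃ₐ[F] E) w₀) • localInvInfAt w₀ c = 0 := by
  have h := Set.mem_range_self (f := localInvInfAt (F := F) w₀) c
  rw [range_localInvInfAt] at h
  exact h

/-- **`n_v · inv_v(c) = 0`** at a finite place. [cite: CasselsFrohlichANT1967, Ch. VII §7.3 Cor. 7.4 (b)] -/
theorem localDegree_nsmul_localInv (v : HeightOneSpectrum (𝓞 F)) (c : groupCohomology (IdeleClassGroup.ideleRep F E) 2) :
    localDegree E v • localInv E v c = 0 :=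
  natCard_stabilizer_nsmul_localInvAt _ c

/-- **`n_v · inv_v(c) = 0`** at an infinite place. [cite: CasselsFrohlichANT1967, Ch. VII §7.3 Cor. 7.4 (b)] -/
theorem infLocalDegree_nsmul_localInvInf (v : InfinitePlace F) (c : groupCohomology (IdeleClassGroup.ideleRep F E) 2) :
    infLocalDegree E v • localInvInf E v c = 0 :=
  natCard_stabilizer_nsmul_localInvInfAt _ c

/-- `inv_v(c) = 0 ↔` the component of `c` at the infinite place `v` vanishes (chosen-place version).
[cite: CasselsFrohlichANT1967, Ch. VII §7.3 Cor. 7.4 (b)] -/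
theorem localInvInf_eq_zero_iff (v : InfinitePlace F) (c : groupCohomology (IdeleClassGroup.ideleRep F E) 2) :
    localInvInf E v c = 0 ↔ groupCohomology.map (MonoidHom.id (E ≃ₐ[F] E)) (infPlaceProj v) 2 c = 0 := by
  have h := localInvInfAt_eq_zero_iff (F := F) (ArchHerbrand.placeOver E v) c
  rw [show (ArchHerbrand.placeOver E v).comap (algebraMap F E) = v from ArchHerbrand.isOver_placeOver (E := E) v] at h
  exact h

/-- **A class all of whose invariants `inv_v` (`v` finite or infinite place of `F`) vanish is zero.**
[cite: CasselsFrohlichANT1967, Ch. VII §7.3 Cor. 7.4 (b)] -/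
theorem eq_zero_of_forall_localInv_eq_zero' (c : groupCohomology (IdeleClassGroup.ideleRep F E) 2)
    (hfin : ∀ v : HeightOneSpectrum (𝓞 F), localInv E v c = 0) (hinf : ∀ v : InfinitePlace F, localInvInf E v c = 0) :
    c = 0 :=
  eq_zero_of_placeComponents_eq_zero (F := F) (E := E) 2 c
    (fun v => (localInvAt_eq_zero_iff (chosenPlace (E := E) v) c).mp (hfin v))
    (fun v => (localInvInf_eq_zero_iff v c).mp (hinf v))

/-- **Two classes with the same local invariants everywhere are equal.** [cite: CasselsFrohlichANT1967, Ch. VII §7.3 Cor. 7.4 (b)] -/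
theorem eq_of_forall_localInv_eq (c c' : groupCohomology (IdeleClassGroup.ideleRep F E) 2)
    (hfin : ∀ v : HeightOneSpectrum (𝓞 F), localInv E v c = localInv E v c')
    (hinf : ∀ v : InfinitePlace F, localInvInf E v c = localInvInf E v c') : c = c' := by
  rw [← sub_eq_zero]
  exact eq_zero_of_forall_localInv_eq_zero' (c - c') (fun v => by rw [map_sub, hfin v, sub_self])
    (fun v => by rw [map_sub, hinf v, sub_self])

/-- **Classes with prescribed local invariants**: for every finitely supported family `(t_v)_v` over the finite places
with `n_v · t_v = 0` and every family `(t'_v)_{v∣∞}` with `n_v · t'_v = 0` there is a class `c ∈ H²(Gal(E/F), J_E)`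
with `inv_v(c) = t_v` and `inv_v(c) = t'_v` — the surjectivity half of `H²(G, J_E) ≅ ⨁_v (1/n_v)ℤ/ℤ`.
[cite: CasselsFrohlichANT1967, Ch. VII §7.3 Cor. 7.4 (b)][cite: Harari2020, §13.1 Prop. 13.1 (b)] -/
theorem exists_localInv_eq (T : Finset (HeightOneSpectrum (𝓞 F))) (t : HeightOneSpectrum (𝓞 F) → AddCircle (1 : ℚ))
    (hT : ∀ v, v ∉ T → t v = 0) (ht : ∀ v, localDegree E v • t v = 0)
    (t' : InfinitePlace F → AddCircle (1 : ℚ)) (ht' : ∀ v, infLocalDegree E v • t' v = 0) :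
    ∃ c : groupCohomology (IdeleClassGroup.ideleRep F E) 2,
      (∀ v, localInv E v c = t v) ∧ ∀ v, localInvInf E v c = t' v := by
  classical
  have hfin : ∀ v : HeightOneSpectrum (𝓞 F), ∃ c : groupCohomology (IdeleClassGroup.ideleRep F E) 2,
      localInv E v c = t v ∧ (∀ v', v' ≠ v → localInv E v' c = 0) ∧ ∀ v', localInvInf E v' c = 0 := by
    intro v
    obtain ⟨y, hy⟩ : t v ∈ Set.range (unitsInvAt (chosenPlace (E := E) v)) := by
      rw [range_unitsInvAt]
      exact ht v
    obtain ⟨c, hc, hc', hc''⟩ := exists_placeComponent_eq v 2 y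
    refine ⟨c, ?_, fun v' hv' => ?_, fun v' => ?_⟩
    · change localInvAt (chosenPlace (E := E) v) c = t v
      rw [localInvAt_eq_unitsInvAt, hc, hy]
    · exact (localInvAt_eq_zero_iff _ c).2 (hc' v' hv')
    · exact (localInvInf_eq_zero_iff v' c).2 (hc'' v')
  have hinf : ∀ v : InfinitePlace F, ∃ c : groupCohomology (IdeleClassGroup.ideleRep F E) 2,
      localInvInf E v c = t' v ∧ (∀ v', localInv E v' c = 0) ∧ ∀ v', v' ≠ v → localInvInf E v' c = 0 := by
    intro v
    obtain ⟨z, hz⟩ : t' v ∈ Set.range (archInvAt (F := F) (ArchHerbrand.placeOver E v)) := by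
      rw [range_archInvAt]
      exact ht' v
    obtain ⟨c, hc, hc', hc''⟩ :=
      exists_infPlaceComponent_eq ((ArchHerbrand.placeOver E v).comap (algebraMap F E)) 2 z
    refine ⟨c, ?_, fun v' => ?_, fun v' hv' => ?_⟩
    · change localInvInfAt (ArchHerbrand.placeOver E v) c = t' v
      rw [localInvInfAt_eq_archInvAt, hc, hz]
    · exact (localInvAt_eq_zero_iff _ c).2 (hc' v')
    · refine (localInvInf_eq_zero_iff v' c).2 (hc'' v' fun h => hv' ?_)
      exact h.trans (ArchHerbrand.isOver_placeOver (E := E) v)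
  choose cf hcf₁ hcf₂ hcf₃ using hfin
  choose ci hci₁ hci₂ hci₃ using hinf
  refine ⟨∑ v ∈ T, cf v + ∑ v, ci v, fun v => ?_, fun v => ?_⟩
  · rw [map_add, map_sum, map_sum, Finset.sum_eq_zero (fun v' _ => hci₂ v' v), add_zero]
    by_cases hv : v ∈ T
    · rw [Finset.sum_eq_single v (fun v' _ hv' => hcf₂ v' v hv'.symm) (fun h => absurd hv h), hcf₁]
    · rw [Finset.sum_eq_zero (fun v' hv' => hcf₂ v' v (ne_of_mem_of_not_mem hv' hv).symm)]
      exact (hT v hv).symm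
  · rw [map_add, map_sum, map_sum, Finset.sum_eq_zero (fun v' _ => hcf₃ v' v), zero_add,
      Finset.sum_eq_single v (fun v' _ hv' => hci₃ v' v hv'.symm) (fun h => absurd (Finset.mem_univ v) h), hci₁]

/-! ## §5. `H²(Gal(E/F), J_E) ≅ ⨁_v (1/n_v)ℤ/ℤ` -/

variable (F E) in
/-- **The family of local invariants `c ↦ ((inv_v c)_v, (inv_v c)_{v∣∞})`** as an additive homomorphism
`H²(Gal(E/F), J_E) →+ (∏_v ℚ/ℤ) × (∏_{v∣∞} ℚ/ℤ)`. [cite: CasselsFrohlichANT1967, Ch. VII §7.3 Cor. 7.4 (b)] -/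
def invFamily : groupCohomology (IdeleClassGroup.ideleRep F E) 2 →+
    (HeightOneSpectrum (𝓞 F) → AddCircle (1 : ℚ)) × (InfinitePlace F → AddCircle (1 : ℚ)) :=
  (AddMonoidHom.pi fun v => localInv E v).prod (AddMonoidHom.pi fun v => localInvInf E v)

/-- Components of `invFamily`. [cite: CasselsFrohlichANT1967, Ch. VII §7.3 Cor. 7.4 (b)] -/
theorem invFamily_apply_fst (c : groupCohomology (IdeleClassGroup.ideleRep F E) 2) (v : HeightOneSpectrum (𝓞 F)) :
    (invFamily F E c).1 v = localInv E v c := rfl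

/-- Components of `invFamily`. [cite: CasselsFrohlichANT1967, Ch. VII §7.3 Cor. 7.4 (b)] -/
theorem invFamily_apply_snd (c : groupCohomology (IdeleClassGroup.ideleRep F E) 2) (v : InfinitePlace F) :
    (invFamily F E c).2 v = localInvInf E v c := rfl

/-- **`H²(Gal(E/F), J_E) → ∏_v ℚ/ℤ` is injective** (a class is determined by its local invariants).
[cite: CasselsFrohlichANT1967, Ch. VII §7.3 Cor. 7.4 (b)] -/
theorem invFamily_injective : Function.Injective (invFamily F E) :=
  (injective_iff_map_eq_zero _).2 fun c hc =>
    eq_zero_of_forall_localInv_eq_zero' c (fun v => congr_fun (congrArg Prod.fst hc) v)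
      (fun v => congr_fun (congrArg Prod.snd hc) v)

/-- **`H²(Gal(E/F), J_E) ≅ ⨁_v (1/n_v)ℤ/ℤ`** (Tate, Cor. 7.4 (b)): the image of `invFamily` is exactly the set of pairs
of families `((t_v)_v, (t'_v)_{v∣∞})` with `(t_v)` finitely supported, `n_v · t_v = 0` and `n_v · t'_v = 0`.
[cite: CasselsFrohlichANT1967, Ch. VII §7.3 Cor. 7.4 (b)][cite: Harari2020, §13.1 Prop. 13.1 (b)] -/
theorem range_invFamily :
    Set.range (invFamily F E) =
      {p | (Function.support p.1).Finite ∧ (∀ v, localDegree E v • p.1 v = 0) ∧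
        ∀ v, infLocalDegree E v • p.2 v = 0} := by
  ext p
  constructor
  · rintro ⟨c, rfl⟩
    exact ⟨finite_support_localInv c, fun v => localDegree_nsmul_localInv v c,
      fun v => infLocalDegree_nsmul_localInvInf v c⟩
  · rintro ⟨hfin, ht, ht'⟩
    obtain ⟨c, hc, hc'⟩ := exists_localInv_eq (E := E) hfin.toFinset p.1
      (fun v hv => by simpa [Function.mem_support] using hv) ht p.2 ht'
    exact ⟨c, Prod.ext (funext hc) (funext hc')⟩

end IdeleCohomology

end Literature.NumberTheory.GaloisRepresentations

end
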